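import Summits.AnomalousDissipation.AnomalousDissipation.Theorems.SolenoidalFractalHomogenisationPermissibleFractalCarrierWords
import Literature.Analysis.FunctionSpaces.TorusAnalyticSeminorm
import Literature.Analysis.FunctionSpaces.TorusTrigPolyDerivBounds
import Literature.Analysis.FunctionSpaces.TorusHeatSmoothing
import HarnessLib

/-!
# Analytic tower of a Lagrangian lattice carrier, I: all-order derivative bounds of the EULERIAN level
# (helper for K1L_D `stmt-AnomalousDissipation-27980`, W3-E (ii) `stub_effectiveFrameEnergyL_bandKill`; `--supports`)

Summits-side helper file (everything proved; no definitions, no named facts). The Eulerian level field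
`level m t = (a_m/N_m) • Σⱼ envⱼ(a_m t) • layerⱼ(N_m • ·)` of a fractal-carrier datum is a finite sum of single real Fourier
modes `layerⱼ(N • x) = Lⱼ(e_{N mⱼ}(x))` (`Lⱼ : ℂ →L[ℝ] ℝ³` the fixed read-out `z ↦ (Im(z e^{iφ})/(2π|mⱼ|)) êⱼ`), so ALL its
space derivatives are explicit: `‖∂^l level m t‖_∞ ≤ (k a_m/(2π N_m)) · (2π N_m Λ_W)^{|l|}` with `Λ_W = Σⱼ ‖mⱼ‖` (`hasDerivBounds_level`),
i.e. in Armstrong–Vicol's analyticity seminorms `⟦level m t⟧_{n,R} ≤ (9/2) · k a_m/(2π N_m)` for every `n` and every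
`R ≥ 2π N_m Λ_W` (`dnorm_level_le`; the factor `9/2 = max_n (n+1)²/n!`). Componentwise versions for the scalar composition /
product estimates of App. A. This is the base (`b 1 = level 1`) and the inserted factor of every step of the analytic tower
(`…LagrangianCarrierAnalyticTower`). Infrastructure for route-1's rung leaf F-D1.A0 (a frontier FORMAL rung); NOT a proof of
anomalous dissipation.
-/

set_option linter.dupNamespace false

noncomputable section

namespace Summit.AnomalousDissipation.AnomalousDissipation.Theorems.SolenoidalFractalHomogenisation.LagrangianCarrierAnalytic

open Set Function Filter Topology Complex
open scoped ContDiff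
open Literature.Analysis Literature.Analysis.FunctionSpaces Literature.Analysis.FunctionSpaces.Torus
open Literature.Analysis.FluidPDE Literature.Analysis.FluidPDE.LatticeShear
open Summit.AnomalousDissipation.AnomalousDissipation.Theorems.SolenoidalFractalHomogenisation.PermissibleCarrier
  (level_eq_smul carrier_nsmul_apply abs_trapezoid_le_one exists_clm_layer_nsmul norm_readout_le)

variable {k : ℕ}

/-! ## §1 Tools: characters and read-outs in the `HasDerivBounds` currency -/

/-- Iterated partials commute with continuous linear maps: `∂^l (L ∘ f) = L ∘ ∂^l f` for smooth `f`. [folklore] -/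
theorem iterPartialDeriv_clm_comp' {F G : Type*} [NormedAddCommGroup F] [NormedSpace ℝ F] [NormedAddCommGroup G]
    [NormedSpace ℝ G] {d : Type*} [Fintype d] [DecidableEq d] {f : UnitAddTorus d → F} (hf : IsSmooth f) (L : F →L[ℝ] G) :
    ∀ l : List d, iterPartialDeriv l (L ∘ f) = L ∘ iterPartialDeriv l f
  | [] => rfl
  | i :: l => by
    rw [iterPartialDeriv_cons, iterPartialDeriv_cons, iterPartialDeriv_clm_comp' hf L l]
    funext x
    exact partialDeriv_clm_comp (hf.iterPartialDeriv l) L i x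

/-- `HasDerivBounds` passes through a continuous linear read-out with the operator norm. [folklore] -/
theorem hasDerivBounds_clm_comp {F G : Type*} [NormedAddCommGroup F] [NormedSpace ℝ F] [NormedAddCommGroup G]
    [NormedSpace ℝ G] {d : Type*} [Fintype d] [DecidableEq d] {f : UnitAddTorus d → F} {n : ℕ} {C Λ : ℝ}
    (hf : HasDerivBounds n f C Λ) (L : F →L[ℝ] G) {K : ℝ} (hK : ‖L‖ ≤ K) :
    HasDerivBounds n (L ∘ f) (K * C) Λ := by
  refine ⟨hf.isSmooth.comp_clm L, fun l hl y => ?_⟩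
  rw [iterPartialDeriv_clm_comp' hf.isSmooth L l, comp_apply]
  calc ‖L (iterPartialDeriv l f y)‖ ≤ ‖L‖ * ‖iterPartialDeriv l f y‖ := L.le_opNorm _
    _ ≤ K * (C * Λ ^ l.length) := mul_le_mul hK (hf.bound hl y) (norm_nonneg _) ((norm_nonneg _).trans hK)
    _ = K * C * Λ ^ l.length := by ring

/-- **Iterated partials of a character**: `∂^l e_q = (∏_{j∈l} 2πi qⱼ) e_q`. [folklore] -/
theorem iterPartialDeriv_mFourier {d : Type*} [Fintype d] [DecidableEq d] (q : d → ℤ) :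
    ∀ l : List d, iterPartialDeriv l (⇑(UnitAddTorus.mFourier q) : UnitAddTorus d → ℂ) =
      fun x => derivMultiplier l q * UnitAddTorus.mFourier q x
  | [] => by funext x; simp
  | j :: l => by
    rw [iterPartialDeriv_cons, iterPartialDeriv_mFourier q l]
    funext x
    have hs : IsSmooth (⇑(UnitAddTorus.mFourier q) : UnitAddTorus d → ℂ) := isSmooth_mFourier q
    have e1 : (fun x => derivMultiplier l q * UnitAddTorus.mFourier q x) =
        (ContinuousLinearMap.mul ℝ ℂ (derivMultiplier l q)) ∘ (⇑(UnitAddTorus.mFourier q) : UnitAddTorus d → ℂ) := by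
      funext y; simp
    rw [e1, partialDeriv_clm_comp hs, partialDeriv_mFourier, derivMultiplier_cons]
    simp only [ContinuousLinearMap.mul_apply']
    ring

/-- A character has `HasDerivBounds n e_q 1 (2π|q|)` at every order. [folklore] -/
theorem hasDerivBounds_mFourier {d : Type*} [Fintype d] [DecidableEq d] (n : ℕ) (q : d → ℤ) :
    HasDerivBounds n (⇑(UnitAddTorus.mFourier q) : UnitAddTorus d → ℂ) 1 (2 * Real.pi * Real.sqrt (freqNormSq q)) := by
  refine ⟨isSmooth_mFourier q, fun l _ x => ?_⟩
  rw [iterPartialDeriv_mFourier q l]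
  simp only
  rw [norm_mul, one_mul]
  have h1 : ‖UnitAddTorus.mFourier q x‖ = 1 := by
    simp only [UnitAddTorus.mFourier, ContinuousMap.coe_mk, norm_prod, fourier_apply, Circle.norm_coe, Finset.prod_const_one]
  rw [h1, mul_one]
  exact norm_derivMultiplier_le l q

/-- `√(freqNormSq (n m)) = n ‖m‖` for the rescaled lattice vector. [folklore] -/
theorem sqrt_freqNormSq_nsmul (m : Fin 3 → ℤ) (n : ℕ) :
    Real.sqrt (freqNormSq (fun i => m i * n)) = n * ‖latticeVec m‖ := by
  have e : freqNormSq (fun i => m i * n) = ((n : ℝ) * ‖latticeVec m‖) ^ 2 := by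
    rw [mul_pow, norm_latticeVec_sq]
    simp only [freqNormSq, Int.cast_mul, Int.cast_natCast, mul_pow, Finset.mul_sum]
    exact Finset.sum_congr rfl fun i _ => by ring
  rw [e, Real.sqrt_sq (by positivity)]

/-- **All-order bounds for one rescaled layer**: `‖∂^l layer(n • ·)‖ ≤ (1/(2π|m|)) (2π n |m|)^{|l|}`. [cite: MeshalkinSinai1961, pp. 1700–1705 (Kolmogorov shear layer)] -/
theorem hasDerivBounds_layer_nsmul (P : LatticePhase) (n N : ℕ) :
    HasDerivBounds N (fun x : UnitAddTorus (Fin 3) => P.layer (n • x)) (1 / (2 * Real.pi * ‖latticeVec P.m‖))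
      (2 * Real.pi * (n * ‖latticeVec P.m‖)) := by
  obtain ⟨L, hL, hcomp⟩ := exists_clm_layer_nsmul P n
  rw [hcomp]
  have hLn : ‖L‖ ≤ 1 / (2 * Real.pi * ‖latticeVec P.m‖) :=
    ContinuousLinearMap.opNorm_le_bound _ (by positivity) fun z => by
      rw [hL z, div_mul_eq_mul_div, one_mul]; exact norm_readout_le P z
  have h := hasDerivBounds_clm_comp (hasDerivBounds_mFourier N (fun i => P.m i * n)) L hLn
  rw [mul_one, sqrt_freqNormSq_nsmul] at h
  rw [← mul_assoc] at h ⊢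
  exact h

/-! ## §2 The Eulerian level -/

/-- The frequency budget `Λ_W = Σⱼ ‖mⱼ‖` of a word dominates each `‖mⱼ‖` and is `≥ 1`. [folklore] -/
theorem norm_latticeVec_le_sum (W : LatticeWord k) (j : Fin k) :
    ‖latticeVec (W.phase j).m‖ ≤ ∑ i, ‖latticeVec (W.phase i).m‖ :=
  Finset.single_le_sum (f := fun i => ‖latticeVec (W.phase i).m‖) (fun _ _ => norm_nonneg _) (Finset.mem_univ j)

/-- `1 ≤ Λ_W`. [folklore] -/
theorem one_le_sum_norm_latticeVec (W : LatticeWord k) : 1 ≤ ∑ i, ‖latticeVec (W.phase i).m‖ :=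
  (one_le_norm_latticeVec (W.phase ⟨0, W.pos⟩).m_ne).trans (norm_latticeVec_le_sum W ⟨0, W.pos⟩)

/-- **All-order bounds for an envelope-weighted combination of rescaled layers** with weights `|cⱼ| ≤ 1`:
`HasDerivBounds N (Σⱼ cⱼ • layerⱼ(n • ·)) (k/(2π)) (2π n Λ_W)`. [cite: ArmstrongVicol2025, §3 (alternating-shear fractal carrier)] -/
theorem hasDerivBounds_layerComb (W : LatticeWord k) (c : Fin k → ℝ) (hc : ∀ j, |c j| ≤ 1) (n N : ℕ) :
    HasDerivBounds N (fun x : UnitAddTorus (Fin 3) => ∑ j, c j • (W.phase j).layer (n • x)) (k * (1 / (2 * Real.pi)))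
      (2 * Real.pi * (n * ∑ i, ‖latticeVec (W.phase i).m‖)) := by
  have hΛ1 : 1 ≤ ∑ i, ‖latticeVec (W.phase i).m‖ := one_le_sum_norm_latticeVec W
  have hL0 : 0 ≤ 2 * Real.pi * (n * ∑ i, ‖latticeVec (W.phase i).m‖) := by positivity
  have hterm : ∀ j ∈ (Finset.univ : Finset (Fin k)),
      HasDerivBounds N (fun x : UnitAddTorus (Fin 3) => c j • (W.phase j).layer (n • x)) (1 / (2 * Real.pi))
        (2 * Real.pi * (n * ∑ i, ‖latticeVec (W.phase i).m‖)) := by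
    intro j _
    have h0 := hasDerivBounds_layer_nsmul (W.phase j) n N
    have hm1 := one_le_norm_latticeVec (W.phase j).m_ne
    have hmj : ‖latticeVec (W.phase j).m‖ ≤ ∑ i, ‖latticeVec (W.phase i).m‖ := norm_latticeVec_le_sum W j
    -- enlarge the constants: `1/(2π|m|) ≤ 1/(2π)`, `2π n |mⱼ| ≤ 2π n Λ`
    have h1 : HasDerivBounds N (fun x : UnitAddTorus (Fin 3) => (W.phase j).layer (n • x)) (1 / (2 * Real.pi))
        (2 * Real.pi * (n * ∑ i, ‖latticeVec (W.phase i).m‖)) := by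
      refine h0.mono ?_ (by positivity) ?_
      · exact one_div_le_one_div_of_le (by positivity) (by nlinarith [Real.pi_pos])
      · have hn : (0 : ℝ) ≤ n := Nat.cast_nonneg _
        nlinarith [Real.pi_pos, mul_le_mul_of_nonneg_left hmj hn]
    have h2 := h1.const_smul (c j)
    have hle : |c j| * (1 / (2 * Real.pi)) ≤ 1 / (2 * Real.pi) := by
      calc |c j| * (1 / (2 * Real.pi)) ≤ 1 * (1 / (2 * Real.pi)) :=
            mul_le_mul_of_nonneg_right (hc j) (by positivity)
        _ = 1 / (2 * Real.pi) := one_mul _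
    exact h2.mono hle hL0 le_rfl
  have hsum := HasDerivBounds.sum Finset.univ hterm
  rw [Finset.sum_const, Finset.card_univ, Fintype.card_fin, nsmul_eq_mul] at hsum
  exact hsum

/-- **All-order derivative bounds of the Eulerian level field** (vector form): for every order `N`,
`HasDerivBounds N (level m t) (k a_m/(2π N_m)) (2π N_m Λ_W)`, `Λ_W = Σⱼ ‖mⱼ‖` the frequency budget of the design.
[cite: ArmstrongVicol2025, §3 (alternating-shear fractal carrier) and App. A (A.1)] -/
theorem hasDerivBounds_level (D : FractalCarrierData k) (m : ℕ) (t : ℝ) (N : ℕ) :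
    HasDerivBounds N (D.level m t) (k * D.a m / (2 * Real.pi * D.N m))
      (2 * Real.pi * (D.N m * ∑ i, ‖latticeVec (D.design.phase i).m‖)) := by
  -- the level as `(a/N) •` an envelope-weighted combination of the layers of `D.word m` (same lattice vectors as the design)
  obtain ⟨c, hc, hlev⟩ : ∃ c : Fin k → ℝ, (∀ j, |c j| ≤ 1) ∧
      D.level m t = fun x => (D.a m / (D.N m : ℝ)) • ∑ j, c j • ((D.word m).phase j).layer (D.N m • x) :=
    ⟨fun j => LatticeWord.trapezoid ((D.word m).start j) ((D.word m).phase j).τ (D.word m).ramp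
        (Int.fract (D.a m * t / (D.word m).period) * (D.word m).period),
      fun j => abs_trapezoid_le_one _ _ _ _, by
        rw [level_eq_smul]; funext x; rw [Pi.smul_apply, carrier_nsmul_apply]⟩
  have hW : (∑ i, ‖latticeVec ((D.word m).phase i).m‖) = ∑ i, ‖latticeVec (D.design.phase i).m‖ :=
    Finset.sum_congr rfl fun i _ => rfl
  have h1 := hasDerivBounds_layerComb (D.word m) c hc (D.N m) N
  rw [hW] at h1
  rw [hlev]
  have h3 := h1.const_smul (D.a m / (D.N m : ℝ))
  have hΛ1 := one_le_sum_norm_latticeVec D.design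
  refine h3.mono (le_of_eq ?_) (by positivity) le_rfl
  have ha : 0 < D.a m := D.a_pos m
  have hNp : (0 : ℝ) < D.N m := by exact_mod_cast D.N_pos m
  rw [abs_of_pos (div_pos ha hNp)]
  field_simp

/-- Componentwise form: each coordinate of the level has the same bounds. [cite: ArmstrongVicol2025, App. A (A.1)] -/
theorem hasDerivBounds_level_coord (D : FractalCarrierData k) (m : ℕ) (t : ℝ) (N : ℕ) (c : Fin 3) :
    HasDerivBounds N (fun x => D.level m t x c) (k * D.a m / (2 * Real.pi * D.N m))
      (2 * Real.pi * (D.N m * ∑ i, ‖latticeVec (D.design.phase i).m‖)) := by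
  have h := hasDerivBounds_level D m t N
  refine ⟨h.isSmooth.apply c, fun l hl y => ?_⟩
  rw [iterPartialDeriv_apply_coord h.isSmooth c l]
  exact ((Real.norm_eq_abs _).le.trans (by exact PiLp.norm_apply_le (iterPartialDeriv l (D.level m t) y) c)).trans (h.bound hl y)

/-! ## §3 Packaging in the analyticity seminorms -/

/-- The numerical constant of the seminorm weights: `(n+1)² ≤ (9/2) · n!`. [cite: ArmstrongVicol2025, App. A (A.1)] -/
theorem sq_succ_le_factorial (n : ℕ) : ((n : ℝ) + 1) ^ 2 ≤ 9 / 2 * (Nat.factorial n : ℝ) := by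
  -- `n ≤ 3` by hand; then induction using `(n+2)² ≤ (n+1)³` for `n ≥ 2`
  suffices h : ∀ n : ℕ, 3 ≤ n → ((n : ℝ) + 1) ^ 2 ≤ 9 / 2 * (Nat.factorial n : ℝ) by
    rcases Nat.lt_or_ge n 3 with hn | hn
    · interval_cases n <;> simp [Nat.factorial] <;> norm_num
    · exact h n hn
  intro n hn
  induction n with
  | zero => omega
  | succ n ih =>
    rcases Nat.lt_or_ge n 3 with hn3 | hn3
    · obtain rfl : n = 2 := by omega
      simp [Nat.factorial]; norm_num
    · have ih' := ih hn3
      have hn2 : (3 : ℝ) ≤ n := by exact_mod_cast hn3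
      rw [Nat.factorial_succ, Nat.cast_mul]
      push_cast
      have hfac : (0 : ℝ) ≤ (Nat.factorial n : ℝ) := Nat.cast_nonneg _
      -- `(n+2)² ≤ (n+1)(n+1)² ≤ (n+1) · (9/2) n!`
      have h1 : ((n : ℝ) + 1 + 1) ^ 2 ≤ ((n : ℝ) + 1) * ((n : ℝ) + 1) ^ 2 := by nlinarith
      calc ((n : ℝ) + 1 + 1) ^ 2 ≤ ((n : ℝ) + 1) * ((n : ℝ) + 1) ^ 2 := h1
        _ ≤ ((n : ℝ) + 1) * (9 / 2 * (Nat.factorial n : ℝ)) := mul_le_mul_of_nonneg_left ih' (by positivity)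
        _ = 9 / 2 * (((n : ℝ) + 1) * (Nat.factorial n : ℝ)) := by ring

/-- From `HasDerivBounds` to the seminorms at any radius `R ≥ Λ`: `⟦f⟧_{n,R} ≤ (9/2) C`. [cite: ArmstrongVicol2025, App. A (A.1)] -/
theorem dnorm_le_of_hasDerivBounds {F : Type*} [NormedAddCommGroup F] [NormedSpace ℝ F] {d : Type*} [Fintype d] [DecidableEq d]
    {f : UnitAddTorus d → F} {n : ℕ} {C Λ R : ℝ} (h : HasDerivBounds n f C Λ) (hΛ : 0 < Λ) (hR : Λ ≤ R) :
    dnorm n R f ≤ 9 / 2 * C := by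
  have hR0 : 0 < R := hΛ.trans_le hR
  have hC := h.nonneg
  refine (h.dnorm_le hΛ.le hR0 le_rfl).trans ?_
  have hq : (Λ / R) ^ n ≤ 1 := pow_le_one₀ (by positivity) ((div_le_one hR0).2 hR)
  have hfac : (0 : ℝ) < (Nat.factorial n : ℝ) := by exact_mod_cast Nat.factorial_pos n
  rw [div_le_iff₀ hfac]
  calc C * ((n : ℝ) + 1) ^ 2 * (Λ / R) ^ n ≤ C * ((n : ℝ) + 1) ^ 2 * 1 := by gcongr
    _ ≤ C * (9 / 2 * (Nat.factorial n : ℝ)) := by rw [mul_one]; exact mul_le_mul_of_nonneg_left (sq_succ_le_factorial n) hC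
    _ = 9 / 2 * C * (Nat.factorial n : ℝ) := by ring

/-- **The Eulerian level in the analyticity seminorms** (vector form): for every order `n` and every radius
`R ≥ 2π N_m Λ_W`, `⟦level m t⟧_{n,R} ≤ (9/2) · k a_m/(2π N_m)`. [cite: ArmstrongVicol2025, App. A (A.1); §3] -/
theorem dnorm_level_le (D : FractalCarrierData k) (m : ℕ) (t : ℝ) (n : ℕ) {R : ℝ}
    (hR : 2 * Real.pi * (D.N m * ∑ i, ‖latticeVec (D.design.phase i).m‖) ≤ R) :
    dnorm n R (D.level m t) ≤ 9 / 2 * (k * D.a m / (2 * Real.pi * D.N m)) := by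
  have hN : (0 : ℝ) < D.N m := by exact_mod_cast D.N_pos m
  have hΛ : 0 < 2 * Real.pi * (D.N m * ∑ i, ‖latticeVec (D.design.phase i).m‖) := by
    have := one_le_sum_norm_latticeVec D.design; positivity
  exact dnorm_le_of_hasDerivBounds (hasDerivBounds_level D m t n) hΛ hR

/-- **The Eulerian level in the analyticity seminorms** (componentwise). [cite: ArmstrongVicol2025, App. A (A.1); §3] -/
theorem dnorm_level_coord_le (D : FractalCarrierData k) (m : ℕ) (t : ℝ) (n : ℕ) (c : Fin 3) {R : ℝ}
    (hR : 2 * Real.pi * (D.N m * ∑ i, ‖latticeVec (D.design.phase i).m‖) ≤ R) :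
    dnorm n R (fun x => D.level m t x c) ≤ 9 / 2 * (k * D.a m / (2 * Real.pi * D.N m)) := by
  have hN : (0 : ℝ) < D.N m := by exact_mod_cast D.N_pos m
  have hΛ : 0 < 2 * Real.pi * (D.N m * ∑ i, ‖latticeVec (D.design.phase i).m‖) := by
    have := one_le_sum_norm_latticeVec D.design; positivity
  exact dnorm_le_of_hasDerivBounds (hasDerivBounds_level_coord D m t n c) hΛ hR

end Summit.AnomalousDissipation.AnomalousDissipation.Theorems.SolenoidalFractalHomogenisation.LagrangianCarrierAnalytic

end
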